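import Summits.RiemannHypothesis.RiemannHypothesis.Theorems.MotivicDoorFfPairLags

/-!
# Motivic door, function-field side (C)(i), part 10a: DILATION — a reader deciding RH over `t² q` decides over `q`;
# the far pair `{3,4}` at dimension 2 is blind over `2ℕ², 6ℕ², 11ℕ², 12ℕ²`
(pub-rhdoor seat ff-1.  HONEST FRAMING: lottery ticket at the motivic door; RH probability negligible; consolation
prizes are real: a new semi-local Weil-positivity theorem, or a located gap in the Connes–Consani programme, plus the
ff-door theorem.  No claim about `ζ`; "RH(q,h)" is `|α| = √q` for the complex roots of ONE integer polynomial `h`.)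

Parts 7–9 classified which trace readers decide RH at dimension `g` and found (part 9b, `{2,3}` at `g = 2`) that
the answer can DEPEND ON `q`.  This file proves the one structural constraint on that dependence and applies it
to the last open lag PAIR at dimension `2`, the far pair `{3, 4}` (both lags beyond the handover `g = 2`).
PROVED here ([folklore] algebra; Mathlib's `Polynomial.scaleRoots`; the angle-twin lemma of pub-rhpf ffmirror-2):

* §1 DILATION `(q, h) ↦ (t² q, h_t)`, `h_t(x) = t^{2g} h(x/t) = scaleRoots h t` (`t ≥ 1`): roots `α ↦ t α`
  (`frobRoots_scaleRoots`), honest of dimension `g` over `q` ↦ honest of dimension `g` over `t² q`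
  (`scaleRoots_honest`), RH ⟺ RH (`ffRH_scaleRoots_iff`), and — the point — the SAME normalised roots `α/√q`,
  hence LITERALLY THE SAME WINDOW TOWER: `weilWindowTower (t²q) h_t = weilWindowTower q h`
  (`weilWindowTower_scaleRoots`, from `ffWindowTower_eq_of_twin`).
* §2 THE DILATION THEOREM `decides_of_decides_sq_mul`: if a tower functional `Φ` (ANY `Φ : Tower → Prop` — window,
  trace, stride, scale-free, …) decides RH on the honest data of dimension `g` over `t² q`, then THE SAME `Φ` decides
  RH on the honest data of dimension `g` over `q`.  So for every reader class the set of `q` at which some member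
  decides is closed under `t² q ↦ q` (`traceReader_decides_of_sq_mul` for the `F`-trace-local class), and the set of
  `q` at which a lag set is BLIND is closed under `q ↦ t² q`.
* §3 `{3, 4}` AT `g = 2` (`s_3 = -a³ + 3ab - 3qa`, `s_4 = a⁴ - 4a²b + 4qa² + 2b² - 4q²` on the honest quartics
  `x⁴ + a x³ + b x² + qa x + q²` of part 9a): four PRIMITIVE witness pairs (RH-true ~ RH-false, equal `s_3, s_4`):
  `q = 2: (-1, 4) ~ (5, 10)`, `q = 6: (3, 3) ~ (-3, 15)`, `q = 11: (0, 5) ~ (12, 59)`, `q = 12: (2, -3) ~ (14, 75)`;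
  hence (`traceReader_three_four_not_decides_sq_mul`) `{3, 4}` does NOT decide RH at dimension `2` over ANY
  `q ∈ {2t², 6t², 11t², 12t² : t ≥ 1}` — infinitely many `q`, by §2 from four hand-checkable lines.

Part 10b (`MotivicDoorFfFarPair`) adds the other side: `{3, 4}` DOES decide at `q = 3, 4, 5, 7` (kernel checks), so
deciding is NOT monotone upward (`3 ↦ 12`), and the table of lag pairs at dimension `2` is complete.
DOOR READING ((i).G): the `q`-dependence of "these finitely many explicit-formula windows certify RH" is
one-directional — refining `q ↦ t² q` can only destroy certification, never create it — because the window tower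
sees the Frobenius ANGLES only.  Nothing here is, or implies, a statement about `ζ`.
-/

set_option linter.dupNamespace false

noncomputable section

open Polynomial Finset

open Summit.RiemannHypothesis.RiemannHypothesis.Theorems.PfPersistence.FfAngleTwin

namespace Summit.RiemannHypothesis.RiemannHypothesis.Theorems.MotivicDoor.FunctionField

/-- The honest quartic `x^4 + a x^3 + b x^2 + q a x + q^2` over `q` (local notation, no definition; as in part 9a). -/
local notation "quart[" q ", " a ", " b "]" =>
  (X ^ 4 + C (a : ℤ) * X ^ 3 + C (b : ℤ) * X ^ 2 + C (((q : ℕ) : ℤ) * (a : ℤ)) * X + C (((q : ℕ) : ℤ) ^ 2) : ℤ[X])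

/-- The RH box of [MN02, Lemma 2.1 (iii)] in integers (local notation, no definition; as in part 9a). -/
local notation "box[" q ", " a ", " b "]" =>
  ((0 : ℤ) ≤ (a : ℤ) ^ 2 - 4 * (b : ℤ) + 8 * ((q : ℕ) : ℤ) ∧ (a : ℤ) ^ 2 ≤ 16 * ((q : ℕ) : ℤ) ∧
    (0 : ℤ) ≤ 2 * ((q : ℕ) : ℤ) + (b : ℤ) ∧ 4 * (a : ℤ) ^ 2 * ((q : ℕ) : ℤ) ≤ (2 * ((q : ℕ) : ℤ) + (b : ℤ)) ^ 2)

/-! ## 1. Dilation of a datum -/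

/-- ROOTS OF THE DILATE: `frobRoots (scaleRoots h t) = t • frobRoots h` (Mathlib `roots_scaleRoots`). [folklore] -/
theorem frobRoots_scaleRoots {h : ℤ[X]} (hh : h.Monic) {t : ℤ} (ht : t ≠ 0) :
    frobRoots (h.scaleRoots t) = (frobRoots h).map (fun α => (t : ℂ) * α) := by
  unfold frobRoots
  have ht' : (Int.castRingHom ℂ) t ≠ 0 := by
    rw [eq_intCast]; exact_mod_cast ht
  rw [map_scaleRoots _ _ _ (by rw [hh.leadingCoeff, map_one]; exact one_ne_zero),
    roots_scaleRoots _ (IsUnit.mk0 _ ht')]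
  simp

/-- THE DILATE IS HONEST: if `h` is honest of dimension `g` over `q` (monic, degree `2g`, functional equation
`q^g c_j = q^i c_i`, `i + j = 2g`), then `h_t = scaleRoots h t` (coefficients `c_i t^{2g-i}`) is honest of dimension
`g` over `t² q`. [folklore] -/
theorem scaleRoots_honest {q g t : ℕ} {h : ℤ[X]} (hh : h.Monic) (hdeg : h.natDegree = 2 * g)
    (hFE : ∀ i j, i + j = 2 * g → (q : ℤ) ^ g * h.coeff j = (q : ℤ) ^ i * h.coeff i) :
    (h.scaleRoots (t : ℤ)).Monic ∧ (h.scaleRoots (t : ℤ)).natDegree = 2 * g ∧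
    ∀ i j, i + j = 2 * g → ((t ^ 2 * q : ℕ) : ℤ) ^ g * (h.scaleRoots (t : ℤ)).coeff j =
      ((t ^ 2 * q : ℕ) : ℤ) ^ i * (h.scaleRoots (t : ℤ)).coeff i := by
  refine ⟨(monic_scaleRoots_iff _).2 hh, by rw [natDegree_scaleRoots, hdeg], ?_⟩
  intro i j hij
  rw [coeff_scaleRoots, coeff_scaleRoots, hdeg, show 2 * g - j = i by omega, show 2 * g - i = j by omega]
  have e := hFE i j hij
  have ht : ((t : ℕ) : ℤ) ^ (2 * g) * ((t : ℕ) : ℤ) ^ i = ((t : ℕ) : ℤ) ^ (2 * i) * ((t : ℕ) : ℤ) ^ j := by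
    rw [← pow_add, ← pow_add]; congr 1; omega
  push_cast
  have e1 : (((t : ℕ) : ℤ) ^ 2 * (q : ℤ)) ^ g = ((t : ℕ) : ℤ) ^ (2 * g) * (q : ℤ) ^ g := by
    rw [mul_pow, ← pow_mul]
  have e2 : (((t : ℕ) : ℤ) ^ 2 * (q : ℤ)) ^ i = ((t : ℕ) : ℤ) ^ (2 * i) * (q : ℤ) ^ i := by
    rw [mul_pow, ← pow_mul]
  rw [e1, e2]
  linear_combination (((t : ℕ) : ℤ) ^ (2 * g) * ((t : ℕ) : ℤ) ^ i) * e + ((q : ℤ) ^ i * h.coeff i) * ht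

/-- `√(t² q) = t √q` for `t ≥ 0`. [folklore] -/
theorem sqrt_sq_mul_natCast (t q : ℕ) : Real.sqrt ((t ^ 2 * q : ℕ) : ℝ) = t * Real.sqrt q := by
  push_cast
  rw [Real.sqrt_mul (by positivity), Real.sqrt_sq (by positivity)]

/-- DILATION KEEPS THE ANGLES: `(t α)/√(t² q) = α/√q`, i.e. the dilate has the same normalised root multiset.
[folklore] -/
theorem normRoots_dilate (q : ℕ) {t : ℕ} (ht : 0 < t) (A : Multiset ℂ) :
    normRoots ((t ^ 2 * q : ℕ) : ℝ) (A.map fun α => (t : ℂ) * α) = normRoots (q : ℝ) A := by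
  unfold normRoots
  rw [Multiset.map_map, sqrt_sq_mul_natCast]
  congr 1
  funext α
  simp only [Function.comp_apply]
  push_cast
  exact mul_div_mul_left _ _ (by exact_mod_cast ht.ne')

/-- DILATION DOES NOT MOVE THE TOWER: `T_M(t² q, h_t) = T_M(q, h)` for every `M` — the window tower sees the
Frobenius angles only (angle-twin lemma `ffWindowTower_eq_of_twin` of pub-rhpf ffmirror-2). [folklore] -/
theorem weilWindowTower_scaleRoots (q : ℕ) {t : ℕ} (ht : 0 < t) {h : ℤ[X]} (hh : h.Monic) :
    weilWindowTower ((t ^ 2 * q : ℕ) : ℝ) (h.scaleRoots (t : ℤ)) = weilWindowTower (q : ℝ) h := by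
  unfold weilWindowTower
  apply ffWindowTower_eq_of_twin
  rw [frobRoots_scaleRoots hh (by exact_mod_cast ht.ne')]
  have : (fun α : ℂ => (((t : ℕ) : ℤ) : ℂ) * α) = fun α : ℂ => ((t : ℕ) : ℂ) * α := by
    funext α; push_cast; rfl
  rw [this]
  exact normRoots_dilate q ht _

/-- DILATION KEEPS RH-STATUS: `RH(t² q, h_t) ⟺ RH(q, h)` (`|t α| = t |α|`). [folklore] -/
theorem ffRH_scaleRoots_iff (q : ℕ) {t : ℕ} (ht : 0 < t) {h : ℤ[X]} (hh : h.Monic) :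
    (∀ α ∈ frobRoots (h.scaleRoots (t : ℤ)), ‖α‖ = Real.sqrt ((t ^ 2 * q : ℕ) : ℝ)) ↔
      ∀ α ∈ frobRoots h, ‖α‖ = Real.sqrt q := by
  rw [frobRoots_scaleRoots hh (by exact_mod_cast ht.ne'), sqrt_sq_mul_natCast]
  simp only [Multiset.mem_map, forall_exists_index, and_imp, forall_apply_eq_imp_iff₂, norm_mul]
  have htn : ‖(((t : ℕ) : ℤ) : ℂ)‖ = (t : ℝ) := by
    push_cast
    exact Complex.norm_natCast t
  have ht' : (0 : ℝ) < t := by exact_mod_cast ht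
  refine forall₂_congr fun α _ => ?_
  rw [htn]
  exact mul_right_inj' ht'.ne'

/-! ## 2. The dilation theorem -/

/-- THE DILATION THEOREM.  If a tower functional `Φ` — any `Φ : Tower → Prop` whatsoever — decides RH on the honest
data of dimension `g` over `t² q` (`t ≥ 1`), then THE SAME `Φ` decides RH on the honest data of dimension `g` over
`q`: the dilate `h_t` of an honest `h` over `q` is honest over `t² q`, has the same tower, and the same RH-status.
(So "decides at `q`" is inherited DOWNWARD along `t² q ↦ q` by every reader class; part 10b shows it is NOT
inherited upward.) [folklore] -/
theorem decides_of_decides_sq_mul {q g t : ℕ} (ht : 0 < t) {Φ : Tower → Prop}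
    (hdec : ∀ h : ℤ[X], h.Monic → h.natDegree = 2 * g →
      (∀ i j, i + j = 2 * g → ((t ^ 2 * q : ℕ) : ℤ) ^ g * h.coeff j = ((t ^ 2 * q : ℕ) : ℤ) ^ i * h.coeff i) →
      (Φ (weilWindowTower ((t ^ 2 * q : ℕ) : ℝ) h) ↔
        ∀ α ∈ frobRoots h, ‖α‖ = Real.sqrt ((t ^ 2 * q : ℕ) : ℝ))) :
    ∀ h : ℤ[X], h.Monic → h.natDegree = 2 * g →
      (∀ i j, i + j = 2 * g → (q : ℤ) ^ g * h.coeff j = (q : ℤ) ^ i * h.coeff i) →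
      (Φ (weilWindowTower (q : ℝ) h) ↔ ∀ α ∈ frobRoots h, ‖α‖ = Real.sqrt q) := by
  intro h hh hdeg hFE
  obtain ⟨hm', hd', hfe'⟩ := scaleRoots_honest (t := t) hh hdeg hFE
  rw [← weilWindowTower_scaleRoots q ht hh, hdec _ hm' hd' hfe', ffRH_scaleRoots_iff q ht hh]

/-- THE DILATION THEOREM FOR TRACE READERS: if some `F`-trace-local reader decides RH at dimension `g` over `t² q`
(`t ≥ 1`), then some `F`-trace-local reader (the same one) decides RH at dimension `g` over `q`.  Equivalently:
the set of `q` over which the lag set `F` is BLIND at dimension `g` is closed under `q ↦ t² q`. [folklore] -/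
theorem traceReader_decides_of_sq_mul {q g t : ℕ} (ht : 0 < t) (F : Set ℕ)
    (hdec : ∃ Φ : Tower → Prop,
      (∀ T T' : Tower, (∀ n ∈ F, T n 0 (Fin.last n) = T' n 0 (Fin.last n)) → Φ T → Φ T') ∧
      ∀ h : ℤ[X], h.Monic → h.natDegree = 2 * g →
        (∀ i j, i + j = 2 * g → ((t ^ 2 * q : ℕ) : ℤ) ^ g * h.coeff j = ((t ^ 2 * q : ℕ) : ℤ) ^ i * h.coeff i) →
        (Φ (weilWindowTower ((t ^ 2 * q : ℕ) : ℝ) h) ↔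
          ∀ α ∈ frobRoots h, ‖α‖ = Real.sqrt ((t ^ 2 * q : ℕ) : ℝ))) :
    ∃ Φ : Tower → Prop,
      (∀ T T' : Tower, (∀ n ∈ F, T n 0 (Fin.last n) = T' n 0 (Fin.last n)) → Φ T → Φ T') ∧
      ∀ h : ℤ[X], h.Monic → h.natDegree = 2 * g →
        (∀ i j, i + j = 2 * g → (q : ℤ) ^ g * h.coeff j = (q : ℤ) ^ i * h.coeff i) →
        (Φ (weilWindowTower (q : ℝ) h) ↔ ∀ α ∈ frobRoots h, ‖α‖ = Real.sqrt q) := by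
  obtain ⟨Φ, hloc, hΦ⟩ := hdec
  exact ⟨Φ, hloc, decides_of_decides_sq_mul ht hΦ⟩

/-! ## 3. The far pair `{3, 4}` at dimension 2: primitive witnesses and the blind square classes -/

/-- A WITNESS PAIR KILLS `{3, 4}`: if an RH-true honest quartic `(a, b)` and an RH-false one `(a', b')` over `q ≥ 1`
share `s_3` and `s_4`, no `{3, 4}`-trace-local reader decides RH at dimension `2` over `q`. [folklore] -/
theorem traceReader_three_four_not_decides_of_witness {q : ℕ} (hq : 0 < q) {a b a' b' : ℤ}
    (hbox : box[q, a, b]) (hnbox : ¬ box[q, a', b'])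
    (E3 : -a' ^ 3 + 3 * a' * b' - 3 * q * a' = -a ^ 3 + 3 * a * b - 3 * q * a)
    (E4 : a' ^ 4 - 4 * a' ^ 2 * b' + 4 * q * a' ^ 2 + 2 * b' ^ 2 - 4 * q ^ 2 =
      a ^ 4 - 4 * a ^ 2 * b + 4 * q * a ^ 2 + 2 * b ^ 2 - 4 * q ^ 2) :
    ¬ ∃ Φ : Tower → Prop,
      (∀ T T' : Tower, (∀ n ∈ ({3, 4} : Set ℕ), T n 0 (Fin.last n) = T' n 0 (Fin.last n)) → Φ T → Φ T') ∧
      ∀ h : ℤ[X], h.Monic → h.natDegree = 2 * 2 →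
        (∀ i j, i + j = 2 * 2 → (q : ℤ) ^ 2 * h.coeff j = (q : ℤ) ^ i * h.coeff i) →
        (Φ (weilWindowTower (q : ℝ) h) ↔ ∀ α ∈ frobRoots h, ‖α‖ = Real.sqrt q) := by
  rintro ⟨Φ, hloc, hdec⟩
  have hqR : (0 : ℝ) < q := by exact_mod_cast hq
  obtain ⟨hm, hd, hfe⟩ := quartic_honest q a b
  obtain ⟨hm', hd', hfe'⟩ := quartic_honest q a' b'
  obtain ⟨-, -, s3, s4⟩ := powerSum_quartic q a b
  obtain ⟨-, -, t3, t4⟩ := powerSum_quartic q a' b'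
  have hΦ := (hdec _ hm hd hfe).2 ((ffRH_quartic_iff hq a b).2 hbox)
  have hcorner : ∀ n ∈ ({3, 4} : Set ℕ), weilWindowTower (q : ℝ) quart[q, a, b] n 0 (Fin.last n) =
      weilWindowTower (q : ℝ) quart[q, a', b'] n 0 (Fin.last n) := by
    intro n hn
    rcases (show n = 3 ∨ n = 4 by simpa using hn) with rfl | rfl
    · exact (corner_eq_iff_powerSum_eq hqR _ _ 3).2 (by rw [s3, t3]; exact_mod_cast E3.symm)
    · exact (corner_eq_iff_powerSum_eq hqR _ _ 4).2 (by rw [s4, t4]; exact_mod_cast E4.symm)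
  have hR' := (hdec _ hm' hd' hfe').1 (hloc _ _ hcorner hΦ)
  exact hnbox ((ffRH_quartic_iff hq a' b').1 hR')

/-- THE FOUR PRIMITIVE WITNESSES (hand-checkable; found by the exact fibre census of the session notes, DATA → here
PROVED): over `q = 2, 6, 11, 12` an RH-true honest quartic and an RH-false one share `s_3, s_4` —
`q = 2: (-1, 4) ~ (5, 10)` (`4a'²q = 200 > 196 = (2q + b')²`), `q = 6: (3, 3) ~ (-3, 15)`, `q = 11: (0, 5) ~ (12, 59)`,
`q = 12: (2, -3) ~ (14, 75)` (the last three fail `a'² - 4b' + 8q ≥ 0`). [folklore] -/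
theorem exists_sThreeFour_witness {q : ℕ} (hq : q = 2 ∨ q = 6 ∨ q = 11 ∨ q = 12) :
    ∃ a b a' b' : ℤ, box[q, a, b] ∧ ¬ box[q, a', b'] ∧
      -a' ^ 3 + 3 * a' * b' - 3 * q * a' = -a ^ 3 + 3 * a * b - 3 * q * a ∧
      a' ^ 4 - 4 * a' ^ 2 * b' + 4 * q * a' ^ 2 + 2 * b' ^ 2 - 4 * q ^ 2 =
        a ^ 4 - 4 * a ^ 2 * b + 4 * q * a ^ 2 + 2 * b ^ 2 - 4 * q ^ 2 := by
  rcases hq with rfl | rfl | rfl | rfl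
  · exact ⟨-1, 4, 5, 10, by norm_num, by norm_num, by norm_num, by norm_num⟩
  · exact ⟨3, 3, -3, 15, by norm_num, by norm_num, by norm_num, by norm_num⟩
  · exact ⟨0, 5, 12, 59, by norm_num, by norm_num, by norm_num, by norm_num⟩
  · exact ⟨2, -3, 14, 75, by norm_num, by norm_num, by norm_num, by norm_num⟩

/-- `{3, 4}` IS BLIND AT DIMENSION 2 OVER `q = 2, 6, 11, 12`. [folklore] -/
theorem traceReader_three_four_not_decides_prim {q : ℕ} (hq : q = 2 ∨ q = 6 ∨ q = 11 ∨ q = 12) :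
    ¬ ∃ Φ : Tower → Prop,
      (∀ T T' : Tower, (∀ n ∈ ({3, 4} : Set ℕ), T n 0 (Fin.last n) = T' n 0 (Fin.last n)) → Φ T → Φ T') ∧
      ∀ h : ℤ[X], h.Monic → h.natDegree = 2 * 2 →
        (∀ i j, i + j = 2 * 2 → (q : ℤ) ^ 2 * h.coeff j = (q : ℤ) ^ i * h.coeff i) →
        (Φ (weilWindowTower (q : ℝ) h) ↔ ∀ α ∈ frobRoots h, ‖α‖ = Real.sqrt q) := by
  have hq0 : 0 < q := by omega
  obtain ⟨a, b, a', b', hbox, hnbox, E3, E4⟩ := exists_sThreeFour_witness hq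
  exact traceReader_three_four_not_decides_of_witness hq0 hbox hnbox E3 E4

/-- FF-DOOR (i).G at `g = 2`, THE FAR PAIR IS BLIND ON FOUR SQUARE CLASSES: for every `t ≥ 1` and
`q₀ ∈ {2, 6, 11, 12}`, NO `{3, 4}`-trace-local reader decides RH at dimension `2` over `q = t² q₀` — infinitely many
`q` (`2, 6, 8, 11, 12, 18, 24, 32, 44, 48, 50, 54, 72, 96, 98, 99, 108, …`) from four witness lines and the dilation
theorem of §2. [folklore] -/
theorem traceReader_three_four_not_decides_sq_mul {q₀ t : ℕ} (hq₀ : q₀ = 2 ∨ q₀ = 6 ∨ q₀ = 11 ∨ q₀ = 12)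
    (ht : 0 < t) :
    ¬ ∃ Φ : Tower → Prop,
      (∀ T T' : Tower, (∀ n ∈ ({3, 4} : Set ℕ), T n 0 (Fin.last n) = T' n 0 (Fin.last n)) → Φ T → Φ T') ∧
      ∀ h : ℤ[X], h.Monic → h.natDegree = 2 * 2 →
        (∀ i j, i + j = 2 * 2 → ((t ^ 2 * q₀ : ℕ) : ℤ) ^ 2 * h.coeff j = ((t ^ 2 * q₀ : ℕ) : ℤ) ^ i * h.coeff i) →
        (Φ (weilWindowTower ((t ^ 2 * q₀ : ℕ) : ℝ) h) ↔
          ∀ α ∈ frobRoots h, ‖α‖ = Real.sqrt ((t ^ 2 * q₀ : ℕ) : ℝ)) :=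
  fun h => traceReader_three_four_not_decides_prim hq₀ (traceReader_decides_of_sq_mul ht _ h)

/-- In particular over `q = 8 = 2² · 2` (used in part 10b's small-`q` table). [folklore] -/
theorem traceReader_three_four_not_decides_eight :
    ¬ ∃ Φ : Tower → Prop,
      (∀ T T' : Tower, (∀ n ∈ ({3, 4} : Set ℕ), T n 0 (Fin.last n) = T' n 0 (Fin.last n)) → Φ T → Φ T') ∧
      ∀ h : ℤ[X], h.Monic → h.natDegree = 2 * 2 →
        (∀ i j, i + j = 2 * 2 → ((8 : ℕ) : ℤ) ^ 2 * h.coeff j = ((8 : ℕ) : ℤ) ^ i * h.coeff i) →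
        (Φ (weilWindowTower ((8 : ℕ) : ℝ) h) ↔ ∀ α ∈ frobRoots h, ‖α‖ = Real.sqrt ((8 : ℕ) : ℝ)) :=
  traceReader_three_four_not_decides_sq_mul (q₀ := 2) (t := 2) (Or.inl rfl) (by norm_num)

end Summit.RiemannHypothesis.RiemannHypothesis.Theorems.MotivicDoor.FunctionField

end
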